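import Literature.NumberTheory.IwasawaTheory.IwasawaAlgebraTwoVar
import Literature.NumberTheory.GaloisRepresentations.NearlyOrdinaryPresentationProofs
import Literature.AlgebraicGeometry.Resolution.RegularLocalRingsUFD
import Literature.AlgebraicGeometry.Resolution.RegularLocalRingsNormal
import Literature.RingTheory.IntegralClosure.PseudoNullSubmoduleOfSquarePresentation
import HarnessLib

/-!
# The two-variable Iwasawa algebra `Λ₂ = ℤ_p⟦T₂⟧⟦T₁⟧` is a regular local ring of dimension 3,
# hence factorial and integrally closed; cokernels of injective endomorphisms of finite free
# `Λ₂`-modules have no non-zero pseudo-null submodule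

Topic `Literature/NumberTheory/IwasawaTheory`; `Proofs` companion of `IwasawaAlgebraTwoVar.lean`
(which identifies the tree's nested receptacle `PowerSeries (PowerSeries ℤ_[p])` — the `abbrev`
`Rubin1991.IwasawaAlgebra₂ p` unfolds to it — with `MvPowerSeries (Fin 2) ℤ_[p]` by
`nestedPowerSeriesEquiv`, and records the standing clauses local / Noetherian / complete / residue
field `𝔽_p`). This file adds the remaining STANDING RING-THEORETIC CLAUSES asked of a
two-variable coefficient ring by the structure theory of Iwasawa modules, all PROVED by
transporting tree theorems along `nestedPowerSeriesEquiv`: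

* `isRegularLocalRing_powerSeries_powerSeries` / `ringKrullDim_powerSeries_powerSeries` — for a
  discrete valuation ring `𝒪`, `𝒪⟦T₂⟧⟦T₁⟧` is a REGULAR local ring of dimension `3` (tree
  `NearlyOrdinaryPresentationCA.isRegularLocalRing_mvPowerSeries_dvr` /
  `ringKrullDim_mvPowerSeries_dvr`: `𝒪⟦X₀, X₁⟧` regular of dimension `2 + 1`, Matsumura 15.4 /
  19.5, moved along the ring isomorphism by Mathlib's `IsRegularLocalRing.of_ringEquiv`);
* `uniqueFactorizationMonoid_powerSeries_powerSeries`, `isIntegrallyClosed_powerSeries_powerSeries`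
  — hence FACTORIAL (Auslander–Buchsbaum, Matsumura 20.3: tree
  `Resolution.uniqueFactorizationMonoid_of_isRegularLocalRing`) and INTEGRALLY CLOSED (Matsumura
  19.4: tree `Resolution.isIntegrallyClosed_of_isRegularLocalRing`);
* the `ℤ_[p]` specialisations `isRegularLocalRing_iwasawaAlgebraTwoVar`,
  `ringKrullDim_iwasawaAlgebraTwoVar`, `uniqueFactorizationMonoid_iwasawaAlgebraTwoVar`,
  `isIntegrallyClosed_iwasawaAlgebraTwoVar`;
* `iwasawaAlgebraTwoVar_range_coker_eq_bot_of_isPseudoNull` /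
  `iwasawaAlgebraTwoVar_eq_bot_of_isPseudoNull_of_exact` — over `Λ₂`, the cokernel of an INJECTIVE
  endomorphism of a finite free module (equivalently any `X` in `0 → F₁ → F₀ → X → 0` with
  `F₁, F₀` finite free of the same rank) has NO non-zero pseudo-null submodule: the tree's
  `IntegralClosure.SquarePresentation.range_coker_eq_bot_of_isPseudoNull` /
  `eq_bot_of_isPseudoNull_of_exact` (Matsumura 11.5 (ii) + Cramer, any normal Noetherian domain)
  with the normality of `Λ₂` supplied here. This is the displayed hypothesis shape "(I2) / (v): every
  pseudo-null `Λ₂`-submodule is `⊥`" of the two-variable main-conjecture files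
  (`Rubin1991.thm53_…` (v), `Viguie2013.prop25_B_noPseudoNull`), UNCONDITIONAL for modules so
  presented (e.g. an `H²` of a perfect Selmer complex `Cone (M →ᵘ M)[-2]` with `M` free, `u`
  injective).

Theorems only (no definition, no named fact, no `instance` — consumers `haveI` the clauses they
need, as with `isNoetherianRing_iwasawaAlgebraTwoVar`).

## References

* [Matsumura1987] H. Matsumura, *Commutative Ring Theory*, CUP 1986: Thm. 15.4 (dimension of
  power series rings), Thm. 19.5 (regularity), Thm. 19.4 (regular ⇒ normal), Thm. 20.3
  (Auslander–Buchsbaum: regular ⇒ factorial), Thm. 11.5 (ii) (`R = ⋂_{ht P = 1} R_P`).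
* [Greenberg2016Selmer] R. Greenberg, *On the structure of Selmer groups* (2016), §1 p. 4 L11–13
  ("`Λ` is isomorphic to a formal power series ring over `ℤ_p` in a finite number of variables").

#harness_tags iwasawa_theory.two_variable, commutative_algebra.regular_local_rings
-/

noncomputable section

namespace Literature.NumberTheory.IwasawaTheory

open Literature.NumberTheory.EllipticCurves Literature.NumberTheory.GaloisRepresentations
  Literature.AlgebraicGeometry.Resolution Literature.RingTheory.IntegralClosure

universe u

/-! ### `𝒪⟦T₂⟧⟦T₁⟧` for a discrete valuation ring `𝒪` -/

section DVR

variable (𝒪 : Type u) [CommRing 𝒪] [IsDomain 𝒪] [IsDiscreteValuationRing 𝒪]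

/-- **`𝒪⟦T₂⟧⟦T₁⟧` is a regular local ring** for a DVR `𝒪` (it is `𝒪⟦X₀, X₁⟧`, regular of
dimension `3`). [cite: Matsumura1987, Thm. 19.5 and Thm. 15.4] -/
theorem isRegularLocalRing_powerSeries_powerSeries :
    IsRegularLocalRing (PowerSeries (PowerSeries 𝒪)) :=
  haveI := NearlyOrdinaryPresentationCA.isRegularLocalRing_mvPowerSeries_dvr 𝒪 2
  IsRegularLocalRing.of_ringEquiv (nestedPowerSeriesEquiv (R := 𝒪)).symm

/-- **`dim 𝒪⟦T₂⟧⟦T₁⟧ = 3`** for a DVR `𝒪`. [cite: Matsumura1987, Thm. 15.4] -/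
theorem ringKrullDim_powerSeries_powerSeries :
    ringKrullDim (PowerSeries (PowerSeries 𝒪)) = 3 := by
  rw [← ringKrullDim_eq_of_ringEquiv (nestedPowerSeriesEquiv (R := 𝒪)).symm,
    NearlyOrdinaryPresentationCA.ringKrullDim_mvPowerSeries_dvr 𝒪 2]
  rfl

/-- **`𝒪⟦T₂⟧⟦T₁⟧` is factorial** (regular local rings are UFDs — Auslander–Buchsbaum).
[cite: Matsumura1987, Thm. 20.3 (PDF p. 179)] -/
theorem uniqueFactorizationMonoid_powerSeries_powerSeries :
    UniqueFactorizationMonoid (PowerSeries (PowerSeries 𝒪)) :=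
  uniqueFactorizationMonoid_of_isRegularLocalRing _ (isRegularLocalRing_powerSeries_powerSeries 𝒪)

/-- **`𝒪⟦T₂⟧⟦T₁⟧` is integrally closed** (regular local rings are normal).
[cite: Matsumura1987, Thm. 19.4] -/
theorem isIntegrallyClosed_powerSeries_powerSeries :
    IsIntegrallyClosed (PowerSeries (PowerSeries 𝒪)) :=
  haveI := isRegularLocalRing_powerSeries_powerSeries 𝒪
  isIntegrallyClosed_of_isRegularLocalRing _

end DVR

/-! ### `Λ₂ = ℤ_p⟦T₂⟧⟦T₁⟧` -/

section Padic

variable (p : ℕ) [Fact p.Prime]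

/-- **`Λ₂ = ℤ_p⟦T₂⟧⟦T₁⟧` is a regular local ring.** [cite: Matsumura1987, Thm. 19.5 and Thm. 15.4] -/
theorem isRegularLocalRing_iwasawaAlgebraTwoVar :
    IsRegularLocalRing (PowerSeries (PowerSeries ℤ_[p])) :=
  isRegularLocalRing_powerSeries_powerSeries ℤ_[p]

/-- **`dim Λ₂ = 3`.** [cite: Matsumura1987, Thm. 15.4] -/
theorem ringKrullDim_iwasawaAlgebraTwoVar : ringKrullDim (PowerSeries (PowerSeries ℤ_[p])) = 3 :=
  ringKrullDim_powerSeries_powerSeries ℤ_[p]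

/-- **`Λ₂` is factorial.** [cite: Matsumura1987, Thm. 20.3 (PDF p. 179)] -/
theorem uniqueFactorizationMonoid_iwasawaAlgebraTwoVar :
    UniqueFactorizationMonoid (PowerSeries (PowerSeries ℤ_[p])) :=
  uniqueFactorizationMonoid_powerSeries_powerSeries ℤ_[p]

/-- **`Λ₂` is integrally closed** (a normal Noetherian domain). [cite: Matsumura1987, Thm. 19.4] -/
theorem isIntegrallyClosed_iwasawaAlgebraTwoVar :
    IsIntegrallyClosed (PowerSeries (PowerSeries ℤ_[p])) :=
  isIntegrallyClosed_powerSeries_powerSeries ℤ_[p]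

/-- **No non-zero pseudo-null submodule over `Λ₂`, endomorphism form.** If `u` is an INJECTIVE
endomorphism of a finite free `Λ₂`-module `M`, every pseudo-null `Λ₂`-submodule of `M ⧸ u(M)` is
`⊥` — the displayed (I2)/(v) hypothesis of the two-variable main-conjecture files, unconditional for
such `M ⧸ u(M)` (Matsumura 11.5 (ii) over the normal Noetherian domain `Λ₂`).
[cite: Matsumura1987, Thm. 11.5 (ii) (p. 82) and Thm. 19.4] -/
theorem iwasawaAlgebraTwoVar_range_coker_eq_bot_of_isPseudoNull {M : Type*} [AddCommGroup M]
    [Module (PowerSeries (PowerSeries ℤ_[p])) M] [Module.Free (PowerSeries (PowerSeries ℤ_[p])) M]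
    [Module.Finite (PowerSeries (PowerSeries ℤ_[p])) M]
    (u : M →ₗ[PowerSeries (PowerSeries ℤ_[p])] M) (hu : Function.Injective u)
    (N : Submodule (PowerSeries (PowerSeries ℤ_[p])) (M ⧸ LinearMap.range u))
    (hN : Module.IsPseudoNull (PowerSeries (PowerSeries ℤ_[p])) N) : N = ⊥ :=
  haveI := isIntegrallyClosed_iwasawaAlgebraTwoVar p
  SquarePresentation.range_coker_eq_bot_of_isPseudoNull u hu N hN

/-- **No non-zero pseudo-null submodule over `Λ₂`, short-exact-sequence form**: if
`0 → F₁ → F₀ → X → 0` is exact with `F₁`, `F₀` finite free `Λ₂`-modules of the same rank, every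
pseudo-null `Λ₂`-submodule of `X` is `⊥`. [cite: Matsumura1987, Thm. 11.5 (ii) (p. 82) and Thm. 19.4] -/
theorem iwasawaAlgebraTwoVar_eq_bot_of_isPseudoNull_of_exact {F₁ F₀ X : Type*}
    [AddCommGroup F₁] [Module (PowerSeries (PowerSeries ℤ_[p])) F₁]
    [Module.Free (PowerSeries (PowerSeries ℤ_[p])) F₁] [Module.Finite (PowerSeries (PowerSeries ℤ_[p])) F₁]
    [AddCommGroup F₀] [Module (PowerSeries (PowerSeries ℤ_[p])) F₀]
    [Module.Free (PowerSeries (PowerSeries ℤ_[p])) F₀] [Module.Finite (PowerSeries (PowerSeries ℤ_[p])) F₀]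
    [AddCommGroup X] [Module (PowerSeries (PowerSeries ℤ_[p])) X]
    (hrk : Module.finrank (PowerSeries (PowerSeries ℤ_[p])) F₁ =
      Module.finrank (PowerSeries (PowerSeries ℤ_[p])) F₀)
    (f : F₁ →ₗ[PowerSeries (PowerSeries ℤ_[p])] F₀) (hf : Function.Injective f)
    (π : F₀ →ₗ[PowerSeries (PowerSeries ℤ_[p])] X) (hπ : Function.Surjective π)
    (hex : Function.Exact f π)
    (N : Submodule (PowerSeries (PowerSeries ℤ_[p])) X)
    (hN : Module.IsPseudoNull (PowerSeries (PowerSeries ℤ_[p])) N) : N = ⊥ :=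
  haveI := isIntegrallyClosed_iwasawaAlgebraTwoVar p
  SquarePresentation.eq_bot_of_isPseudoNull_of_exact hrk f hf π hπ hex N hN

end Padic

end Literature.NumberTheory.IwasawaTheory

end
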